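import Mathlib.Analysis.Calculus.BumpFunction.SmoothApprox
import Mathlib.Analysis.Calculus.ContDiff.RCLike
import Mathlib.Topology.MetricSpace.HausdorffDimension
import Mathlib.Topology.MetricSpace.HausdorffDistance
import Mathlib.Topology.Homotopy.Basic
import Mathlib.Topology.UrysohnsLemma
import Mathlib.Topology.OpenPartialHomeomorph.Basic
import Mathlib.Topology.UniformSpace.HeineCantor
import HarnessLib

/-!
# General position in a chart: pushing a map off a thin closed set

Let `M` be a Hausdorff space, `e` a partial homeomorphism of `M` onto an open subset of a
finite-dimensional real normed space `E` (a chart), and `C ⊆ M` a closed set lying in the chart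
whose chart image `e '' C` is *thin for `k`-dimensional general position*: it is covered by
countably many images `G j '' O j` of `C¹` maps `G j` defined on open subsets `O j ⊆ ℝᵈ` with
`d + k < dim E`.  We prove (`exists_homotopyRel_forall_notMem`): a continuous map `f : K → M` from
a compact space `K` which is a uniform retract of a `k`-dimensional real normed space `W` (e.g.
`K = [0, 1]`, `W = ℝ`, or `K = [0, 1]²`, `W = ℝ²`) is homotopic, relative to any closed set
`Z ⊆ K` whose image avoids `C`, to a map `g` avoiding `C`; moreover the homotopy avoids any
prescribed closed set `C₀` that `f` avoids (so it stays inside a prescribed open set, and does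
not undo earlier pushes).

This is the classical general position lemma (Hirsch, *Differential Topology* (1976), Ch. 3,
Thm. 2.5; Kosinski, *Differential Manifolds* (1993), VI.2), in the form used for the fundamental
group of the complement of a union of submanifolds of codimension `≥ 2` / `≥ 3`; it generalises
the tree's `Literature.AlgebraicTopology.FundamentalGroupoid.exists_continuousMap_eqOn_forall_ne`
(`SimplyConnectedComplPoint.lean`, the case `C = {p}`), whose proof is followed: write `f = e⁻¹ ∘ h`
near `f⁻¹(C)`, approximate `h` uniformly by a smooth `g₁` on `W`
(`UniformContinuous.exists_contDiff_dist_le`), observe that the vectors `v` for which `g₁ - v`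
meets `e '' C` form a set of Hausdorff dimension `≤ d + k < dim E`, hence with dense complement
(`dense_setOf_forall_sub_notMem`, from `dimH_image_le_of_locally_lipschitzOn` and
`dense_compl_of_dimH_lt_finrank`), and interpolate with an Urysohn cut-off:
`F_s = e⁻¹ (h + s φ (g₁ - v - h))`.

Everything is proved; no definitions.

## References

* M. W. Hirsch, *Differential Topology*, GTM 33, Springer (1976), Ch. 3, Thm. 2.5. [HirschDT1976]
* A. Kosinski, *Differential Manifolds*, Academic Press (1993), VI.2.
* A. Hatcher, *Algebraic Topology*, CUP (2002), proof of Prop. 1.14. [HatcherAT2002]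
-/

noncomputable section

open Set Metric Topology unitInterval Function Module Filter
open scoped NNReal ENNReal

namespace Literature.AlgebraicTopology.FundamentalGroupoid

section Thin

variable {E : Type*} [NormedAddCommGroup E] [NormedSpace ℝ E] [FiniteDimensional ℝ E]
  {W : Type*} [NormedAddCommGroup W] [NormedSpace ℝ W] [FiniteDimensional ℝ W]

/-- **Translates of a `k`-dimensional smooth family generically miss a thin set.**  If
`S ⊆ E` is covered by countably many images `G j '' O j` of maps that are `C¹` on open subsets
`O j ⊆ ℝᵈ`, and `g : W → E` is `C¹` with `d + dim W < dim E`, then the set of vectors `v` such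
that `g - v` misses `S` is dense: its complement is contained in
`⋃ j, {g w - G j u | w ∈ W, u ∈ O j}`, a countable union of locally Lipschitz images of sets of
Hausdorff dimension `≤ dim W + d < dim E` (Sard's theorem in its easy, dimension-counting form).
[folklore] -/
theorem dense_setOf_forall_sub_notMem {ι : Type*} [Countable ι] {d : ℕ}
    (O : ι → Set (Fin d → ℝ)) (G : ι → (Fin d → ℝ) → E) (hO : ∀ j, IsOpen (O j))
    (hG : ∀ j, ContDiffOn ℝ 1 (G j) (O j)) {S : Set E} (hS : S ⊆ ⋃ j, G j '' O j)
    {g : W → E} (hg : ContDiff ℝ 1 g) (hdim : d + finrank ℝ W < finrank ℝ E) :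
    Dense {v : E | ∀ w, g w - v ∉ S} := by
  -- the bad set and its parametrisations
  set Φ : ι → W × (Fin d → ℝ) → E := fun j p => g p.1 - G j p.2 with hΦ
  have hbad : {v : E | ∀ w, g w - v ∉ S}ᶜ ⊆ ⋃ j, Φ j '' (univ ×ˢ O j) := by
    intro v hv
    simp only [mem_compl_iff, mem_setOf_eq, not_forall, not_not] at hv
    obtain ⟨w, hw⟩ := hv
    obtain ⟨j, hj⟩ := mem_iUnion.1 (hS hw)
    obtain ⟨u, hu, hgu⟩ := hj
    refine mem_iUnion.2 ⟨j, ⟨(w, u), ⟨mem_univ _, hu⟩, ?_⟩⟩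
    simp only [hΦ, hgu, sub_sub_cancel]
  -- each parametrisation is locally Lipschitz on its (open) domain
  have hdim_j : ∀ j, dimH (Φ j '' (univ ×ˢ O j)) ≤ (d + finrank ℝ W : ℕ) := by
    intro j
    have hopen : IsOpen ((univ : Set W) ×ˢ O j) := isOpen_univ.prod (hO j)
    have hsmooth : ContDiffOn ℝ 1 (Φ j) (univ ×ˢ O j) := by
      refine (hg.comp_contDiffOn contDiffOn_fst).sub ?_
      exact (hG j).comp contDiffOn_snd fun p hp => hp.2
    have hlip : ∀ p ∈ (univ : Set W) ×ˢ O j, ∃ C : ℝ≥0, ∃ t ∈ 𝓝[univ ×ˢ O j] p,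
        LipschitzOnWith C (Φ j) t := by
      intro p hp
      have hat : ContDiffAt ℝ 1 (Φ j) p := (hsmooth p hp).contDiffAt (hopen.mem_nhds hp)
      obtain ⟨C, t, ht, hC⟩ := hat.exists_lipschitzOnWith
      exact ⟨C, t, mem_nhdsWithin_of_mem_nhds ht, hC⟩
    calc dimH (Φ j '' (univ ×ˢ O j)) ≤ dimH ((univ : Set W) ×ˢ O j) :=
          dimH_image_le_of_locally_lipschitzOn hlip
      _ ≤ dimH (univ : Set (W × (Fin d → ℝ))) := dimH_mono (subset_univ _)
      _ = finrank ℝ (W × (Fin d → ℝ)) := Real.dimH_univ_eq_finrank _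
      _ = (d + finrank ℝ W : ℕ) := by
          rw [Module.finrank_prod, Module.finrank_fin_fun]; push_cast; ring
  have hlt : dimH ({v : E | ∀ w, g w - v ∉ S}ᶜ) < finrank ℝ E := by
    calc dimH ({v : E | ∀ w, g w - v ∉ S}ᶜ) ≤ dimH (⋃ j, Φ j '' (univ ×ˢ O j)) := dimH_mono hbad
      _ = ⨆ j, dimH (Φ j '' (univ ×ˢ O j)) := dimH_iUnion _
      _ ≤ (d + finrank ℝ W : ℕ) := iSup_le hdim_j
      _ < finrank ℝ E := by exact_mod_cast hdim
  simpa only [compl_compl] using dense_compl_of_dimH_lt_finrank hlt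

end Thin

section Perturb

variable {E : Type*} [NormedAddCommGroup E] [NormedSpace ℝ E] [FiniteDimensional ℝ E]
  {W : Type*} [NormedAddCommGroup W] [NormedSpace ℝ W] [FiniteDimensional ℝ W]
  {K : Type*} [UniformSpace K] [CompactSpace K]
  {M : Type*} [TopologicalSpace M] [T2Space M]

omit [NormedSpace ℝ E] [FiniteDimensional ℝ E] in
/-- For a nonempty `C' ⊆ closedBall c R`, points at `infDist ≤ r` from `C'` lie in
`closedBall c (R + r)`. [folklore] -/
theorem mem_closedBall_of_infDist_le {C' : Set E} {c : E} {R r : ℝ} (hC' : C'.Nonempty)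
    (hC'R : C' ⊆ closedBall c R) {y : E} (hy : infDist y C' ≤ r) : y ∈ closedBall c (R + r) := by
  rw [mem_closedBall]
  refine le_of_forall_pos_lt_add fun ε hε => ?_
  obtain ⟨c', hc', hyc'⟩ := (infDist_lt_iff hC').1 (show infDist y C' < r + ε by linarith)
  calc dist y c ≤ dist y c' + dist c' c := dist_triangle _ _ _
    _ < (r + ε) + R := add_lt_add_of_lt_of_le hyc' (hC'R hc')
    _ = R + r + ε := by ring

/-- **General position off a thin closed set, in one chart.**  Let `e` be a partial
homeomorphism of the Hausdorff space `M` into the finite-dimensional real normed space `E`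
with `closedBall c (R + 2) ⊆ e.target`; let `C ⊆ e.source` be closed with
`e '' C ⊆ closedBall c R` covered by countably many images `G j '' O j` of maps `C¹` on open
sets `O j ⊆ ℝᵈ`; let `K` be a compact uniform space which is a uniform retract of a
finite-dimensional real normed space `W` (`π ∘ ι = id`, `ι` continuous, `π` uniformly
continuous) with `d + dim W < dim E`; and let `f : K → M` be continuous, avoiding a closed set
`C₀`, with `f '' Z` avoiding `C` for a closed `Z ⊆ K`.  Then there are a continuous
`g : K → M` avoiding `C` and a homotopy from `f` to `g` relative to `Z` all of whose values avoid
`C₀` (general position: smoothing and a dimension count, Hirsch, *Differential Topology* (1976),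
Ch. 3, Thm. 2.5; the case of a point is
`Literature.AlgebraicTopology.FundamentalGroupoid.exists_continuousMap_eqOn_forall_ne`). [folklore] -/
theorem exists_homotopyRel_forall_notMem {ι' : K → W} {π : W → K} (hι : Continuous ι')
    (hπ : UniformContinuous π) (hπι : ∀ x, π (ι' x) = x)
    (e : OpenPartialHomeomorph M E) {c : E} {R : ℝ} (hRt : closedBall c (R + 2) ⊆ e.target)
    {ι : Type*} [Countable ι] {d : ℕ} (O : ι → Set (Fin d → ℝ)) (G : ι → (Fin d → ℝ) → E)
    (hO : ∀ j, IsOpen (O j)) (hG : ∀ j, ContDiffOn ℝ 1 (G j) (O j))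
    (hdim : d + finrank ℝ W < finrank ℝ E)
    {C : Set M} (hCs : C ⊆ e.source) (hCc : IsClosed C) (hCR : ∀ z ∈ C, e z ∈ closedBall c R)
    (hCG : e '' C ⊆ ⋃ j, G j '' O j)
    {C₀ : Set M} (hC₀ : IsClosed C₀)
    (f : C(K, M)) (hf₀ : ∀ x, f x ∉ C₀) {Z : Set K} (hZ : IsClosed Z) (hfZ : ∀ z ∈ Z, f z ∉ C) :
    ∃ g : C(K, M), (∀ x, g x ∉ C) ∧ ∃ F : f.HomotopyRel g Z, ∀ p, F p ∉ C₀ := by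
  classical
  -- The trivial case `C = ∅`.
  rcases C.eq_empty_or_nonempty with rfl | hCne
  · exact ⟨f, fun x h => h, ContinuousMap.HomotopyRel.refl f Z, fun p => by
      simpa using hf₀ p.2⟩
  -- Notation: the chart image `C'` of `C`, compact and nonempty, inside `closedBall c R`.
  set C' : Set E := e '' C with hC'_def
  have hC'ne : C'.Nonempty := hCne.image e
  have hC'R : C' ⊆ closedBall c R := by
    rintro _ ⟨z, hz, rfl⟩; exact hCR z hz
  have htarget_symm : ∀ y ∈ e.target, (e.symm y ∈ C ↔ y ∈ C') := by
    intro y hy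
    constructor
    · intro h
      exact ⟨e.symm y, h, e.right_inv hy⟩
    · rintro ⟨z, hz, rfl⟩
      rw [e.left_inv (hCs hz)]
      exact hz
  have hBt : closedBall c (R + 1) ⊆ e.target :=
    (closedBall_subset_closedBall (by linarith)).trans hRt
  have hRt' : closedBall c R ⊆ e.target := (closedBall_subset_closedBall (by linarith)).trans hRt
  have hC'eq : C' = closedBall c R ∩ e.symm ⁻¹' C := by
    ext y
    constructor
    · rintro ⟨z, hz, rfl⟩
      exact ⟨hCR z hz, by rw [mem_preimage, e.left_inv (hCs hz)]; exact hz⟩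
    · rintro ⟨hy, hyC⟩
      exact (htarget_symm y (hRt' hy)).1 hyC
  have hC'c : IsClosed C' := by
    rw [hC'eq]
    exact (e.continuousOn_symm.mono hRt').preimage_isClosed_of_isClosed isClosed_closedBall hCc
  have hC'cpt : IsCompact C' := (isCompact_closedBall c R).of_isClosed_subset hC'c hC'R
  -- The coordinate expression `h = e ∘ f` on `S = f⁻¹(e.source)` and the distance to `C'`.
  set S : Set K := f ⁻¹' e.source with hS_def
  have hSo : IsOpen S := e.open_source.preimage f.continuous
  set h : K → E := fun x => e (f x) with hh_def
  have hcont : ContinuousOn h S := e.continuousOn.comp f.continuous.continuousOn fun x hx => hx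
  set D : K → ℝ := fun x => infDist (h x) C' with hD_def
  have hDcont : ContinuousOn D S := (continuous_infDist_pt C').comp_continuousOn hcont
  have hfx : ∀ x ∈ S, e.symm (h x) = f x := fun x hx => e.left_inv hx
  -- The tubes `A r ⊆ O r'` (`r < r'`) around `f⁻¹(C)`, for radii `≤ 1`.
  set A : ℝ → Set K := fun r => {x | x ∈ S ∧ D x ≤ r} with hA_def
  set Otube : ℝ → Set K := fun r => {x | x ∈ S ∧ D x < r} with hO_def
  have hAS : ∀ r, A r ⊆ S := fun r x hx => hx.1
  have hOA : ∀ r, Otube r ⊆ A r := fun r x hx => ⟨hx.1, hx.2.le⟩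
  have hAO : ∀ r r', r < r' → A r ⊆ Otube r' := fun r r' hrr' x hx => ⟨hx.1, hx.2.trans_lt hrr'⟩
  have hAA : ∀ r r', r ≤ r' → A r ⊆ A r' := fun r r' hrr' x hx => ⟨hx.1, hx.2.trans hrr'⟩
  have hOO : ∀ r r', r ≤ r' → Otube r ⊆ Otube r' := fun r r' hrr' x hx =>
    ⟨hx.1, hx.2.trans_le hrr'⟩
  have hhB : ∀ {r : ℝ}, r ≤ 1 → ∀ x ∈ A r, h x ∈ closedBall c (R + 1) := fun hr x hx =>
    closedBall_subset_closedBall (by linarith) (mem_closedBall_of_infDist_le hC'ne hC'R hx.2)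
  have hAc : ∀ r, r ≤ 1 → IsClosed (A r) := by
    intro r hr
    have heq : A r = f ⁻¹' (e.symm '' (closedBall c (R + 1) ∩ {y | infDist y C' ≤ r})) := by
      ext x
      constructor
      · intro hx
        exact ⟨h x, ⟨hhB hr x hx, hx.2⟩, hfx x hx.1⟩
      · rintro ⟨y, ⟨hyB, hyr⟩, hyx⟩
        have hyt : y ∈ e.target := hBt hyB
        have hxS : x ∈ S := by
          change f x ∈ e.source
          rw [← hyx]; exact e.map_target hyt
        have hhx : h x = y := by
          change e (f x) = y
          rw [← hyx, e.right_inv hyt]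
        exact ⟨hxS, by change infDist (h x) C' ≤ r; rw [hhx]; exact hyr⟩
    rw [heq]
    refine IsClosed.preimage f.continuous (IsCompact.isClosed ?_)
    refine ((isCompact_closedBall c (R + 1)).inter_right
      (isClosed_le (continuous_infDist_pt C') continuous_const)).image_of_continuousOn ?_
    exact e.continuousOn_symm.mono fun y hy => hBt hy.1
  have hOo : ∀ r, r ≤ 1 → IsOpen (Otube r) := by
    intro r hr
    have hsub : {y : E | infDist y C' < r} ⊆ e.target := fun y hy =>
      hBt (closedBall_subset_closedBall (by linarith)
        (mem_closedBall_of_infDist_le hC'ne hC'R (le_of_lt hy)))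
    have heq : Otube r = f ⁻¹' (e.symm '' {y | infDist y C' < r}) := by
      ext x
      constructor
      · intro hx
        exact ⟨h x, hx.2, hfx x hx.1⟩
      · rintro ⟨y, hyr, hyx⟩
        have hyt : y ∈ e.target := hsub hyr
        have hxS : x ∈ S := by
          change f x ∈ e.source
          rw [← hyx]; exact e.map_target hyt
        have hhx : h x = y := by
          change e (f x) = y
          rw [← hyx, e.right_inv hyt]
        exact ⟨hxS, by change infDist (h x) C' < r; rw [hhx]; exact hyr⟩
    rw [heq]
    refine IsOpen.preimage f.continuous ?_
    exact e.symm.isOpen_image_of_subset_source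
      (isOpen_lt (continuous_infDist_pt C') continuous_const) (by rw [e.symm_source]; exact hsub)
  -- `f⁻¹(C)` lies in every tube; outside `S` or at positive distance, `f ∉ C`.
  have hfC : ∀ x, f x ∈ C → x ∈ S ∧ D x = 0 := fun x hx =>
    ⟨hCs hx, infDist_zero_of_mem ⟨f x, hx, rfl⟩⟩
  have hnotC : ∀ x, (x ∈ S → 0 < D x) → f x ∉ C := fun x hx hfx' =>
    (hx (hfC x hfx').1).ne' (hfC x hfx').2
  -- Step 0: a radius `ρ` with `A (4ρ)` disjoint from `Z`, `4ρ ≤ 1`.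
  obtain ⟨ρ, hρ, hρ1, hρZ⟩ : ∃ ρ : ℝ, 0 < ρ ∧ 4 * ρ ≤ 1 ∧ ∀ z ∈ Z, z ∉ A (4 * ρ) := by
    rcases (A 1 ∩ Z).eq_empty_or_nonempty with hemp | hne
    · refine ⟨1 / 4, by norm_num, by norm_num, fun z hz hzA => ?_⟩
      have : z ∈ A 1 ∩ Z := ⟨by simpa using hzA, hz⟩
      rw [hemp] at this
      exact this
    · have hcpt : IsCompact (A 1 ∩ Z) := ((hAc 1 le_rfl).inter hZ).isCompact
      obtain ⟨z₀, hz₀, hmin⟩ := hcpt.exists_isMinOn hne (hDcont.mono fun x hx => hx.1.1)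
      have hpos : 0 < D z₀ := by
        have hz₀C : h z₀ ∉ C' := fun hmem => hfZ z₀ hz₀.2 (by
          rw [← hfx z₀ hz₀.1.1]
          exact (htarget_symm (h z₀) (hBt (hhB le_rfl z₀ hz₀.1))).2 hmem)
        exact (hC'c.notMem_iff_infDist_pos hC'ne).1 hz₀C
      refine ⟨min (D z₀ / 8) (1 / 8), by positivity, ?_, fun z hz hzA => ?_⟩
      · linarith [min_le_right (D z₀ / 8) (1 / 8)]
      · have hz1 : z ∈ A 1 := hAA _ 1 (by linarith [min_le_right (D z₀ / 8) (1 / 8)]) hzA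
        have hle : D z₀ ≤ D z := hmin ⟨hz1, hz⟩
        have : D z ≤ 4 * min (D z₀ / 8) (1 / 8) := hzA.2
        linarith [min_le_left (D z₀ / 8) (1 / 8)]
  -- Step 0': a protection radius `δ₀` for `C₀`.
  obtain ⟨δ₀, hδ₀, hδ₀1, hprot⟩ : ∃ δ₀ : ℝ, 0 < δ₀ ∧ δ₀ ≤ 1 ∧
      ∀ x ∈ A 1, ∀ w : E, ‖w‖ < δ₀ → h x + w ∈ e.target ∧ e.symm (h x + w) ∉ C₀ := by
    set C₀' : Set E := closedBall c (R + 2) ∩ e.symm ⁻¹' C₀ with hC₀'_def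
    have hC₀'c : IsClosed C₀' :=
      (e.continuousOn_symm.mono hRt).preimage_isClosed_of_isClosed isClosed_closedBall hC₀
    have hmemB2 : ∀ x ∈ A 1, ∀ w : E, ‖w‖ < 1 → h x + w ∈ closedBall c (R + 2) := by
      intro x hx w hw
      have h1 := hhB le_rfl x hx
      rw [mem_closedBall] at h1 ⊢
      calc dist (h x + w) c ≤ dist (h x + w) (h x) + dist (h x) c := dist_triangle _ _ _
        _ ≤ 1 + (R + 1) := by
            refine add_le_add ?_ h1
            rw [dist_eq_norm, add_sub_cancel_left]; exact hw.le
        _ = R + 2 := by ring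
    have hkey : ∀ x ∈ A 1, ∀ w : E, ‖w‖ < 1 → e.symm (h x + w) ∈ C₀ → h x + w ∈ C₀' :=
      fun x hx w hw hmem => ⟨hmemB2 x hx w hw, hmem⟩
    rcases C₀'.eq_empty_or_nonempty with hemp | hne
    · refine ⟨1, one_pos, le_rfl, fun x hx w hw => ⟨hRt (hmemB2 x hx w hw), fun hmem => ?_⟩⟩
      have := hkey x hx w hw hmem
      rw [hemp] at this
      exact this
    · rcases (A 1).eq_empty_or_nonempty with hAemp | hAne
      · refine ⟨1, one_pos, le_rfl, fun x hx => ?_⟩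
        rw [hAemp] at hx; exact hx.elim
      obtain ⟨x₀, hx₀, hmin⟩ := (hAc 1 le_rfl).isCompact.exists_isMinOn hAne
        (((continuous_infDist_pt C₀').comp_continuousOn hcont).mono (hAS 1))
      have hpos : 0 < infDist (h x₀) C₀' := by
        refine (hC₀'c.notMem_iff_infDist_pos hne).1 fun hmem => hf₀ x₀ ?_
        rw [← hfx x₀ hx₀.1]
        exact hmem.2
      refine ⟨min (infDist (h x₀) C₀') 1, lt_min hpos one_pos, min_le_right _ _,
        fun x hx w hw => ⟨hRt (hmemB2 x hx w (hw.trans_le (min_le_right _ _))), fun hmem => ?_⟩⟩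
      have hw1 : ‖w‖ < 1 := hw.trans_le (min_le_right _ _)
      have hin : h x + w ∈ C₀' := hkey x hx w hw1 hmem
      have h1 : infDist (h x) C₀' ≤ ‖w‖ := by
        have := infDist_le_dist_of_mem (x := h x) hin
        rwa [dist_eq_norm, sub_add_cancel_left, norm_neg] at this
      have h2 : infDist (h x₀) C₀' ≤ infDist (h x) C₀' := hmin hx
      linarith [hw.trans_le (min_le_left _ _)]
  -- Step 1: Urysohn cut-offs `φ` (`= 1` on `A ρ`, `= 0` off `O 2ρ`) and `χ` (`= 1` on `A 3ρ`,
  -- `= 0` off `O 4ρ`).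
  obtain ⟨φ, hφ0, hφ1, hφ01⟩ := exists_continuous_zero_one_of_isClosed
    (hOo (2 * ρ) (by linarith)).isClosed_compl (hAc ρ (by linarith))
    (disjoint_compl_left_iff_subset.2 (hAO ρ (2 * ρ) (by linarith)))
  obtain ⟨χ, hχ0, hχ1, -⟩ := exists_continuous_zero_one_of_isClosed
    (hOo (4 * ρ) hρ1).isClosed_compl (hAc (3 * ρ) (by linarith))
    (disjoint_compl_left_iff_subset.2 (hAO (3 * ρ) (4 * ρ) (by linarith)))
  -- Step 2: the coordinate expression cut off to a global continuous map, extended to `W` and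
  -- smoothed within `ε₁`.
  set Fc : K → E := fun x => χ x • h x with hFc_def
  have hFc : Continuous Fc := by
    rw [continuous_iff_continuousAt]
    intro x
    by_cases hx : x ∈ S
    · exact (χ.continuous.continuousAt).smul (hcont.continuousAt (hSo.mem_nhds hx))
    · have hx' : x ∉ A 1 := fun h' => hx (hAS _ h')
      have hev : (fun _ => (0 : E)) =ᶠ[𝓝 x] Fc := by
        filter_upwards [(hAc 1 le_rfl).isOpen_compl.mem_nhds hx'] with y hy
        have hy' : y ∈ (Otube (4 * ρ))ᶜ := fun hy' => hy (hAA _ _ hρ1 (hOA _ hy'))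
        have : χ y = 0 := hχ0 hy'
        simp only [hFc_def, this, zero_smul]
      exact continuousAt_const.congr hev
  set ε₁ : ℝ := min (ρ / 4) (δ₀ / 4) with hε₁_def
  have hε₁ : 0 < ε₁ := by positivity
  have hε₁ρ : ε₁ ≤ ρ / 4 := min_le_left _ _
  have hε₁δ : ε₁ ≤ δ₀ / 4 := min_le_right _ _
  have huc : UniformContinuous (Fc ∘ π) :=
    (CompactSpace.uniformContinuous_of_continuous hFc).comp hπ
  obtain ⟨g₁, hg₁, hg₁d⟩ := huc.exists_contDiff_dist_le hε₁
  have hg₁1 : ContDiff ℝ 1 g₁ := hg₁.of_le (by exact_mod_cast le_top)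
  have happrox : ∀ x ∈ A (3 * ρ), ‖g₁ (ι' x) - h x‖ < ε₁ := by
    intro x hx
    have hχx : χ x = 1 := hχ1 hx
    have hFx : (Fc ∘ π) (ι' x) = h x := by
      simp only [comp_apply, hπι, hFc_def, hχx, one_smul]
    rw [← dist_eq_norm, ← hFx]
    exact hg₁d (ι' x)
  -- Step 3: a small generic vector `v`: `g₁ - v` misses `C'`.
  have hdense : Dense {v : E | ∀ w, g₁ w - v ∉ C'} :=
    dense_setOf_forall_sub_notMem O G hO hG hCG hg₁1 hdim
  obtain ⟨v, hv, hvε⟩ := hdense.exists_mem_open isOpen_ball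
    ⟨(0 : E), mem_ball_self hε₁⟩
  rw [mem_ball_zero_iff] at hvε
  -- Step 4: the perturbation and its size.
  set pert : ℝ → K → E := fun s x => s • (φ x • (g₁ (ι' x) - v - h x)) with hpert_def
  have hφle : ∀ x, ‖φ x‖ ≤ 1 := fun x => by
    have := hφ01 x
    rw [Real.norm_eq_abs, abs_le]
    exact ⟨by linarith [this.1], this.2⟩
  have hpert : ∀ s ∈ Icc (0 : ℝ) 1, ∀ x ∈ A (3 * ρ), ‖pert s x‖ < 2 * ε₁ := by
    intro s hs x hx
    have hd' : ‖g₁ (ι' x) - v - h x‖ < 2 * ε₁ := by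
      calc ‖g₁ (ι' x) - v - h x‖ = ‖(g₁ (ι' x) - h x) - v‖ := by congr 1; abel
        _ ≤ ‖g₁ (ι' x) - h x‖ + ‖v‖ := norm_sub_le _ _
        _ < ε₁ + ε₁ := add_lt_add (happrox x hx) hvε
        _ = 2 * ε₁ := by ring
    calc ‖pert s x‖ = ‖s‖ * (‖φ x‖ * ‖g₁ (ι' x) - v - h x‖) := by
          rw [hpert_def, norm_smul, norm_smul]
      _ ≤ 1 * (1 * ‖g₁ (ι' x) - v - h x‖) := by
          have hs' : ‖s‖ ≤ 1 := by rw [Real.norm_eq_abs, abs_le]; exact ⟨by linarith [hs.1], hs.2⟩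
          gcongr
          · exact hφle x
      _ < 2 * ε₁ := by rw [one_mul, one_mul]; exact hd'
  have hpertδ : ∀ s ∈ Icc (0 : ℝ) 1, ∀ x ∈ A (3 * ρ), ‖pert s x‖ < δ₀ := fun s hs x hx =>
    (hpert s hs x hx).trans_le (by linarith)
  have hA3 : A (3 * ρ) ⊆ A 1 := hAA _ _ (by linarith)
  -- the perturbed map in the chart region
  set gin : ℝ → K → M := fun s x => e.symm (h x + pert s x) with hgin_def
  have hgin_cont : ContinuousOn (fun p : I × K => gin p.1 p.2) (univ ×ˢ A (3 * ρ)) := by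
    have h1 : ContinuousOn (fun p : I × K => h p.2 + pert p.1 p.2) (univ ×ˢ A (3 * ρ)) := by
      refine ContinuousOn.add (hcont.comp continuous_snd.continuousOn fun p hp => hA3 hp.2 |>.1) ?_
      refine ContinuousOn.smul (continuous_subtype_val.comp continuous_fst).continuousOn ?_
      refine ContinuousOn.smul (φ.continuous.comp continuous_snd).continuousOn ?_
      exact ((hg₁.continuous.comp (hι.comp continuous_snd)).continuousOn.sub continuousOn_const).sub
        (hcont.comp continuous_snd.continuousOn fun p hp => (hA3 hp.2).1)
    refine e.continuousOn_symm.comp h1 fun p hp => ?_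
    exact (hprot p.2 (hA3 hp.2) _ (hpertδ p.1 p.1.2 p.2 hp.2)).1
  have hgin_eq : ∀ (s : I) (x : K), x ∈ S → x ∉ Otube (2 * ρ) → gin s x = f x := by
    intro s x hxS hxO
    have : φ x = 0 := hφ0 hxO
    simp only [hgin_def, hpert_def, this, zero_smul, smul_zero, add_zero, hfx x hxS]
  -- Step 5: the homotopy, pieced together with `f` off the tube `O 3ρ`.
  set Hmap : I × K → M := fun p => if p.2 ∈ Otube (3 * ρ) then gin p.1 p.2 else f p.2 with hHmap_def
  have hclos : closure (Otube (3 * ρ)) ⊆ A (3 * ρ) :=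
    closure_minimal (hOA _) (hAc _ (by linarith))
  have hHcont : Continuous Hmap := by
    have heq : Hmap = (univ ×ˢ Otube (3 * ρ)).piecewise (fun p : I × K => gin p.1 p.2)
        (fun p => f p.2) := by
      funext p
      simp only [hHmap_def, Set.piecewise, mem_prod, mem_univ, true_and]
    rw [heq]
    refine continuous_piecewise (fun p hp => ?_) (hgin_cont.mono ?_)
      (f.continuous.comp continuous_snd).continuousOn
    · -- on the frontier `φ = 0`, so `gin = f`
      have hp2 : p.2 ∈ frontier (Otube (3 * ρ)) := by
        have : p ∈ frontier ((univ : Set I) ×ˢ Otube (3 * ρ)) := hp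
        rw [frontier_univ_prod_eq] at this
        exact this.2
      have ha1 : p.2 ∈ A (3 * ρ) := hclos (frontier_subset_closure hp2)
      have ha2 : p.2 ∉ Otube (3 * ρ) := by
        have := hp2.2
        rwa [(hOo _ (by linarith)).interior_eq] at this
      exact hgin_eq p.1 p.2 ha1.1 fun h' => ha2 (hOO _ _ (by linarith) h')
    · intro p hp
      rw [closure_prod_eq, closure_univ] at hp
      exact ⟨mem_univ _, hclos hp.2⟩
  have hH_in : ∀ (s : I) (x : K), x ∈ Otube (3 * ρ) → Hmap (s, x) = gin s x := fun s x hx => by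
    simp only [hHmap_def, hx, if_true]
  have hH_out : ∀ (s : I) (x : K), x ∉ Otube (3 * ρ) → Hmap (s, x) = f x := fun s x hx => by
    simp only [hHmap_def, hx, if_false]
  -- properties of the homotopy
  have hH0 : ∀ x, Hmap (0, x) = f x := by
    intro x
    by_cases hx : x ∈ Otube (3 * ρ)
    · rw [hH_in 0 x hx]
      simp only [hgin_def, hpert_def, Icc.coe_zero, zero_smul, add_zero, hfx x hx.1]
    · exact hH_out 0 x hx
  have hHZ : ∀ (s : I), ∀ z ∈ Z, Hmap (s, z) = f z := by
    intro s z hz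
    refine hH_out s z fun hzO => hρZ z hz ?_
    exact hAA _ _ (by linarith) (hOA _ hzO)
  have hHC₀ : ∀ p, Hmap p ∉ C₀ := by
    rintro ⟨s, x⟩
    by_cases hx : x ∈ Otube (3 * ρ)
    · rw [hH_in s x hx]
      exact (hprot x (hA3 (hOA _ hx)) _ (hpertδ s s.2 x (hOA _ hx))).2
    · rw [hH_out s x hx]; exact hf₀ x
  have hH1C : ∀ x, Hmap (1, x) ∉ C := by
    intro x
    by_cases hx : x ∈ Otube (3 * ρ)
    · rw [hH_in 1 x hx]
      intro hmem
      have hxA : x ∈ A (3 * ρ) := hOA _ hx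
      have ht : h x + pert 1 x ∈ e.target := (hprot x (hA3 hxA) _ (hpertδ 1 ⟨zero_le_one, le_rfl⟩ x hxA)).1
      have hmem' : h x + pert 1 x ∈ C' := (htarget_symm _ ht).1 hmem
      by_cases hφx : φ x = 1
      · -- then the perturbed point is `g₁ (ι x) - v`, not in `C'`
        have : h x + pert 1 x = g₁ (ι' x) - v := by
          simp only [hpert_def, hφx, one_smul]; abel
        rw [this] at hmem'
        exact hv (ι' x) hmem'
      · -- then `D x > ρ` while the perturbation has norm `< ρ/2`
        have hxA' : x ∉ A ρ := fun h' => hφx (hφ1 h')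
        have hρx : ρ < D x := by
          by_contra hle
          exact hxA' ⟨hx.1, not_lt.1 hle⟩
        have h1 : D x ≤ ‖pert 1 x‖ := by
          have := infDist_le_dist_of_mem (x := h x) hmem'
          rwa [dist_eq_norm, sub_add_cancel_left, norm_neg] at this
        have h2 : ‖pert 1 x‖ < 2 * ε₁ := hpert 1 ⟨zero_le_one, le_rfl⟩ x hxA
        linarith
    · rw [hH_out 1 x hx]
      refine hnotC x fun hxS => ?_
      by_contra hle
      exact hx ⟨hxS, lt_of_le_of_lt (not_lt.1 hle) (by linarith)⟩
  -- Conclusion.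
  let Hc : C(I × K, M) := ⟨Hmap, hHcont⟩
  let g : C(K, M) := ⟨fun x => Hmap (1, x), hHcont.comp (by fun_prop)⟩
  refine ⟨g, hH1C, ?_, ?_⟩
  · exact
      { toFun := Hmap
        continuous_toFun := hHcont
        map_zero_left := hH0
        map_one_left := fun x => rfl
        prop' := fun s z hz => hHZ s z hz }
  · intro p
    exact hHC₀ p

end Perturb

end Literature.AlgebraicTopology.FundamentalGroupoid
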